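import Literature.Analysis.FluidPDE.PineauVicolRSSChaeWolf
import HarnessLib

/-!
# Crux `NoTypeIBlowup` (stmt-NavierStokesRegularity-1217), line `killing-twisted-bernoulli-solitons`:
  stub `rssCompact_exists_pressure_of_cover` — one pressure on an open time set from an open cover

In the compactness step (openness in `α` of the Pineau–Vicol RSS Liouville property) the
RSS-symmetric limit velocity `v` is a classical Navier–Stokes solution on each member `S k` of a
countable family of OPEN time windows, each with its own pressure `q k`, the windows covering the
open time set `T` (`∀ t ∈ T, ∃ k, t ∈ S k`; `S k ⊆ T` is not needed). This file patches the
pressures into ONE pressure on `T`.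

-- adapted from `Literature.Analysis.FluidPDE.IsClassicalNSSolutionOn.exists_pressure_Iio_of_Ioo`
-- (Literature/Analysis/FluidPDE/PineauVicolRSSChaeWolf.lean; there the pieces are `Ioo (a k) 0`
-- and the target is `Iio 0`), copied and generalised, not imported.

Proof. Choose for `t ∈ T` an index `K t` with `t ∈ S (K t)` and put
`P t x := q (K t) t x - q (K t) t 0`. On an overlap `S j ∩ S k` (open, hence a neighbourhood of
each of its points) the normalised pressures agree, because the momentum equation determines
`∇q (t, ·)` (`IsClassicalNSSolutionOn.pressure_sub_apply_zero_eq_of_eventuallyEq`). Hence on the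
relatively open piece `(T ×ˢ univ) ∩ (S (K t) ×ˢ univ)` around `(t, x)` the field `P` coincides
with the jointly smooth `q (K t) - q (K t) (·, 0)` (`IsSmoothSpaceTimeOn.sub_apply_zero`), so `P`
(and likewise `v`) is jointly smooth on `T ×ˢ univ` (`contDiffOn_of_locally_contDiffOn`). The
momentum equation within `T` at `t` is the one within `S (K t)`: both time sets are neighbourhoods
of `t`, so both one-sided time derivatives are the two-sided one (`derivWithin_of_mem_nhds`), and
`∇(P t) = ∇(q (K t) t)` (`gradient_sub_const`). Divergence-freeness is read off piece `K t`.
Lands `--supports stmt-NavierStokesRegularity-1217`.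
-/

noncomputable section

namespace Summit.NavierStokesRegularity.NavierStokesRegularity.Theorems

open Set Filter Topology Function
open scoped ContDiff
open Literature.Analysis.FluidPDE

/-- **One pressure on an open time set from pressures on an open cover.** If the same velocity
field `v` is, for every `k`, a classical solution on the open time set `S k` with some pressure
`q k` (same viscosity `ν` and force `f`), and every `t` of the open time set `T` lies in some
`S k`, then `v` is a classical solution on `T` with a single pressure: the momentum equations
force `∇q_j = ∇q_k` on overlaps (`pressure_sub_apply_zero_eq_of_eventuallyEq`), so the normalised
pressures `q_k(t,x) − q_k(t,0)` patch to one jointly smooth field (smoothness is local,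
`contDiffOn_of_locally_contDiffOn`), and at `t ∈ T ∩ S k` the time derivatives within `T` and
within `S k` are both the two-sided derivative (`derivWithin_of_mem_nhds`). [folklore] -/
theorem rssCompact_exists_pressure_of_cover :
    ∀ (ν : ℝ) (f v : ℝ → EuclideanSpace ℝ (Fin 3) → EuclideanSpace ℝ (Fin 3)) (T : Set ℝ)
      (S : ℕ → Set ℝ) (q : ℕ → ℝ → EuclideanSpace ℝ (Fin 3) → ℝ),
      IsOpen T → (∀ k, IsOpen (S k)) → (∀ t ∈ T, ∃ k, t ∈ S k) →
      (∀ k, Literature.Analysis.FluidPDE.IsClassicalNSSolutionOn (S k) ν f v (q k)) →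
      ∃ P : ℝ → EuclideanSpace ℝ (Fin 3) → ℝ,
        Literature.Analysis.FluidPDE.IsClassicalNSSolutionOn T ν f v P := by
  intro ν f v T S q hT hS hcov hsol
  choose! K hK using hcov
  -- normalised pressures agree on overlaps of the (open) windows
  have hagree : ∀ (j k : ℕ) (t : ℝ), t ∈ S j → t ∈ S k → ∀ x : EuclideanSpace ℝ (Fin 3),
      q j t x - q j t 0 = q k t x - q k t 0 :=
    fun j k t hj hk x => (hsol j).pressure_sub_apply_zero_eq_of_eventuallyEq (hsol k)
      ((hS j).mem_nhds hj) ((hS k).mem_nhds hk) (Eventually.of_forall fun _ => rfl) x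
  refine ⟨fun t x => q (K t) t x - q (K t) t 0, ?_, ?_, ?_, ?_⟩
  · -- joint smoothness of the velocity is local
    refine contDiffOn_of_locally_contDiffOn fun z hz => ?_
    obtain ⟨t, x⟩ := z
    have ht : t ∈ T := hz.1
    refine ⟨S (K t) ×ˢ univ, (hS (K t)).prod isOpen_univ, ⟨hK t ht, mem_univ x⟩, ?_⟩
    exact ContDiffOn.mono (hsol (K t)).smooth_velocity inter_subset_right
  · -- joint smoothness of the patched pressure is local
    refine contDiffOn_of_locally_contDiffOn fun z hz => ?_
    obtain ⟨t, x⟩ := z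
    have ht : t ∈ T := hz.1
    refine ⟨S (K t) ×ˢ univ, (hS (K t)).prod isOpen_univ, ⟨hK t ht, mem_univ x⟩, ?_⟩
    refine (ContDiffOn.mono (hsol (K t)).smooth_pressure.sub_apply_zero
      inter_subset_right).congr fun z hz => ?_
    obtain ⟨τ, y⟩ := z
    have hτT : τ ∈ T := hz.1.1
    have hτS : τ ∈ S (K t) := hz.2.1
    simp only [uncurry_apply_pair]
    exact hagree (K τ) (K t) τ (hK τ hτT) hτS y
  · -- momentum equation: read off the window `S (K t)`
    intro t ht x
    have hD : timeDerivWithin T v t x = timeDerivWithin (S (K t)) v t x := by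
      simp only [timeDerivWithin_apply]
      rw [derivWithin_of_mem_nhds (hT.mem_nhds ht),
        derivWithin_of_mem_nhds ((hS (K t)).mem_nhds (hK t ht))]
    rw [hD, gradient_sub_const]
    exact (hsol (K t)).momentum t (hK t ht) x
  · -- divergence free: read off the window `S (K t)`
    intro t ht
    exact (hsol (K t)).divFree t (hK t ht)

end Summit.NavierStokesRegularity.NavierStokesRegularity.Theorems
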